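import Summits.AtomisticToContinuum.FouriersLaw.Theorems.JunctionLocalityNonBallisticStubInfiniteVolumeWitness
import Summits.AtomisticToContinuum.FouriersLaw.Theses.CurrentTiltQuench
import Summits.AtomisticToContinuum.FouriersLaw.Theses.CoercivePulse
import Summits.AtomisticToContinuum.FouriersLaw.Theses.NoHiddenChargesKubo
import Summits.AtomisticToContinuum.FouriersLaw.Theses.CageBudgetFekete
import Summits.AtomisticToContinuum.FouriersLaw.Theses.HoelderEscapeProfile

/-!
# `SymmetricSetup` (stmt-AtomisticToContinuum-11036) — proved

The symmetric infinite-volume set-up shared verbatim by routes CurrentTiltQuench / NoHiddenChargesKubo (support) and CoercivePulse /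
CageBudgetFekete / HoelderEscapeProfile (crux): for `pinnedChain ω₂ lam β γ` (`ω₂, lam, β > 0`, ANY bath constant `γ` — it is inert for
the infinite chain) and every `T > 0` there are a DLR Gibbs state `μ_T` which is shift-invariant and momentum-reversal invariant and an
infinite-volume dynamics `D` preserving `μ_T` whose flow commutes with the unit shift `μ_T`-a.e.

Proof = the witness package `stub_infiniteVolumeWitness` (WIT, p143465) of line `drude-controls-conductance` of crux stmt-9127 with its
idle hypothesis `0 < γ` dropped and the absolute-convergence clause discarded: the shift-invariant superstable DLR state at `T`
(`OscillatorChain.exists_isChainGibbsMeasure_shiftInvariant_superstable_pinnedChain`, transfer operator), reversal invariance BY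
UNIQUENESS in the shift-invariant class (`eq_of_isChainGibbsMeasure_of_isShiftInvariant_pinnedChain` +
`map_momentumReversalZ_eq_of_regular_unique`), a Buttà–Marchioro dynamics on the canonical carrier `𝒳₀`
(`OscillatorChain.exists_bmDynamics`, preserving every superstable DLR state) and a.e. shift-covariance of its flow
(`InfiniteChainDynamics.flow_comp_chainShift_ae_of_carrier_eq_bmGood`). This is also the `birth` line of the crux directory
`Cruxes/SymmetricSetup` (stubs `stub_superstableGibbsState` / `stub_shiftInvariantGibbsUnique` / `stub_superstableDynamics`, each ONE
landed tree theorem). Lead c4 of stmt-9127 lands it as the de-vacuifier of the CurrentTiltQuench items 11026–11032 on which stmt-9127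
now hinges. No definitions.
-/

noncomputable section

namespace Summit.AtomisticToContinuum.FouriersLaw.Theorems.CurrentTiltQuench

open MeasureTheory ProbabilityTheory Filter Topology Set Function
open scoped NNReal ENNReal BigOperators
open Literature.MathematicalPhysics.KineticTheory
open Literature.MathematicalPhysics.KineticTheory.HeatConduction

/-- **`SymmetricSetup` (stmt-AtomisticToContinuum-11036), CurrentTiltQuench copy.** For `ω₂, lam, β > 0`, any `γ`, and `T > 0`: a
shift-invariant, momentum-reversal-invariant DLR Gibbs state `μ` of `pinnedChain ω₂ lam β γ` at `T` and a `μ`-preserving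
`InfiniteChainDynamics` commuting with the unit shift `μ`-a.e. exist (transfer-operator DLR state × uniqueness in the shift-invariant
class × Buttà–Marchioro flow on `𝒳₀`). [cite: ButtaMarchioro2016, §2 Thm 2.1 and §3] -/
theorem symmetricSetup_proof : Summit.AtomisticToContinuum.FouriersLaw.Theses.CurrentTiltQuench.SymmetricSetup := by
  intro ω₂ lam β γ hω hl hβ T hT
  -- the chain data
  have hU1 : OscillatorChain.IsEvenPolyOfDegree (pinnedChain ω₂ lam β γ).U 2 :=
    OscillatorChain.pinnedChain_isEvenPolyOfDegree_U β γ hω.le hl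
  have hV1 : OscillatorChain.IsEvenPolyOfDegree (pinnedChain ω₂ lam β γ).V 2 :=
    OscillatorChain.pinnedChain_isEvenPolyOfDegree_V ω₂ lam γ hβ
  have hU0 : ∀ r, 0 ≤ (pinnedChain ω₂ lam β γ).U r := hU1.choose_spec.2.2
  have hV0 : ∀ r, 0 ≤ (pinnedChain ω₂ lam β γ).V r := hV1.choose_spec.2.2
  -- the state: the shift-invariant superstable DLR state at `T`
  obtain ⟨μ, hG, hS, hss⟩ :=
    OscillatorChain.exists_isChainGibbsMeasure_shiftInvariant_superstable_pinnedChain γ hω hl.le hβ.le hT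
  -- the dynamics: Buttà–Marchioro, carrier `𝒳₀`
  obtain ⟨D, hcar, -, -, -, -, -, hpres⟩ := OscillatorChain.exists_bmDynamics (P := pinnedChain ω₂ lam β γ)
    (by norm_num) (by norm_num) hU1 hV1
  have hD : D.PreservesMeasure μ := hpres T μ hG hss
  -- uniqueness in the regular class, hence reversal invariance
  have huniq : ∀ μ₁ μ₂ : Measure ChainConfig,
      (pinnedChain ω₂ lam β γ).IsChainGibbsMeasure T μ₁ → IsShiftInvariant μ₁ →
      (pinnedChain ω₂ lam β γ).HasSuperstabilityEstimate μ₁ →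
      (pinnedChain ω₂ lam β γ).IsChainGibbsMeasure T μ₂ → IsShiftInvariant μ₂ →
      (pinnedChain ω₂ lam β γ).HasSuperstabilityEstimate μ₂ → μ₁ = μ₂ :=
    fun μ₁ μ₂ h₁ hS₁ _ h₂ hS₂ _ =>
      OscillatorChain.eq_of_isChainGibbsMeasure_of_isShiftInvariant_pinnedChain γ hω hl.le hβ.le hT
        h₁ hS₁ h₂ hS₂
  have hrev : μ.map (fun σ : ChainConfig => fun x : ℤ => ((σ x).1, -(σ x).2)) = μ := by
    have h := OscillatorChain.map_momentumReversalZ_eq_of_regular_unique hG hS hss huniq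
    rw [coe_momentumReversalZ] at h
    exact h
  -- a.e. commutation with the unit shift
  have hshift : ∀ t : ℝ, ∀ᵐ σ ∂μ, D.flow t (shift σ) = shift (D.flow t σ) := by
    intro t
    filter_upwards [D.flow_comp_chainShift_ae_of_carrier_eq_bmGood hcar hU0 hV0 hD.1 t 1] with σ hσ
    rw [← chainShift_one]
    exact hσ
  exact ⟨μ, hG, hS, hrev, D, hD, hshift⟩

/-- `CoercivePulse.SymmetricSetup` (the crux copy of stmt-11036; one statement, `Iff.rfl`). [cite: ButtaMarchioro2016, §2 Thm 2.1 and §3] -/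
theorem coercivePulse_symmetricSetup_proof :
    Summit.AtomisticToContinuum.FouriersLaw.Theses.CoercivePulse.SymmetricSetup :=
  symmetricSetup_proof

/-- `NoHiddenChargesKubo.SymmetricSetup` (support copy of stmt-11036; `Iff.rfl`). [cite: ButtaMarchioro2016, §2 Thm 2.1 and §3] -/
theorem noHiddenChargesKubo_symmetricSetup_proof :
    Summit.AtomisticToContinuum.FouriersLaw.Theses.NoHiddenChargesKubo.SymmetricSetup :=
  symmetricSetup_proof

/-- `CageBudgetFekete.SymmetricSetup` (crux copy of stmt-11036; `Iff.rfl`). [cite: ButtaMarchioro2016, §2 Thm 2.1 and §3] -/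
theorem cageBudgetFekete_symmetricSetup_proof :
    Summit.AtomisticToContinuum.FouriersLaw.Theses.CageBudgetFekete.SymmetricSetup :=
  symmetricSetup_proof

/-- `HoelderEscapeProfile.SymmetricSetup` (crux copy of stmt-11036; `Iff.rfl`). [cite: ButtaMarchioro2016, §2 Thm 2.1 and §3] -/
theorem hoelderEscapeProfile_symmetricSetup_proof :
    Summit.AtomisticToContinuum.FouriersLaw.Theses.HoelderEscapeProfile.SymmetricSetup :=
  symmetricSetup_proof

end Summit.AtomisticToContinuum.FouriersLaw.Theorems.CurrentTiltQuench

end
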